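import Summits.SmoothPoincare4.SmoothPoincare4.Theorems.CylinderEntropyCylinderRungTwoFluxIdentity
import HarnessLib

/-!
# With a pocket, the two sides of the cross-section differ

Registered helper `helper_sidesDifferOfPocket` (wave 1, brick W1a) of line `killing-flux` of the crux
`CylinderEntropy.CylinderRungTwo` (stmt-SmoothPoincare4-7631). Everything here is proved
(no named facts); theorems only.

Let `N = {z ∈ ℝ⁶ | ∑_{i<5} zᵢ² = 1} = S⁴ × ℝ`, `M` a compact boundaryless `4`-manifold,
`ι : M → ℝ⁶` a smooth embedding with image in `N`, `ν` a continuous unit normal field along `ι`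
tangent to `N`, and let `a₊, a₋` be the side constants of the `±ν` push-offs (the truth value of
"joined in `N ∖ ι(M)` to a point of height `≤ -R`", constant on the `+ν`, resp. `-ν`, push-offs,
as produced by `exists_side_constants`). If `N ∖ ι(M)` has a *pocket* — a point `z` that is not
joined in `N ∖ ι(M)` to any point of height `≤ -R` — then `a₊ ≠ a₋` (as truth values).

*Proof.* Suppose `a₊ ↔ a₋`. Then the global jump `d = [a₋] - [a₊]` vanishes, so by the
telescoping crossing count `low_sub_low_eq_sum` the side "lower" does not change along the
vertical line over any `p ∈ S⁴` with finite regular fibre (between heights off `ι(M)`); far below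
every vertical line is lower, so every point off `ι(M)` of such a line is lower. Such `p` form a
set of full `μHE⁴`-measure in `S⁴` (multiplicity area formula + nullity of the critical shadow,
exactly as in the assembly of `stub_fluxIdentity`), and caps `S⁴ ∩ B(x, r)` have positive measure
(rotation invariance of the spherical Hausdorff measure), so there is such a `p` arbitrarily close
to the shadow `truncL z` of the pocket point. But `z` is joined in `N ∖ ι(M)` to the point
`(p, z₅)` for `p` close to `truncL z` (radial projection of the chord, `ι(M)` being closed), so
`(p, z₅)` is not lower — a contradiction.
-/

-- the prescribed namespace `Summit.SmoothPoincare4.SmoothPoincare4.…` repeats `SmoothPoincare4`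
set_option linter.dupNamespace false

noncomputable section

open MeasureTheory Set Function Filter Module
open scoped Manifold ContDiff ENNReal Topology RealInnerProductSpace NNReal

namespace Summit.SmoothPoincare4.SmoothPoincare4.Theorems.CylinderRungTwo.KillingFlux

open Literature.Geometry.Riemannian
open Literature.Geometry.Lorentzian Literature.Geometry.Lorentzian.PseudoRiemannianMetric
open Literature.Geometry.Riemannian.SphericalCylinderEntropy (truncL truncL_apply
  hausdorffMeasure_sphere_four_pos)
open Literature.Geometry.Manifold.CylinderSlice (axis padL castSucc_ne_five)

section Pocket

/-! ### Local path-connectedness of `N` off a closed set -/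

/-- **Nearby slice points are joined off a closed set.** If `z ∈ N` lies off the closed set `A`,
then every point `(q, z₅)` with `q ∈ S⁴` close to `truncL z` is joined to `z` in `N ∖ A`: the map
`v ↦ (v/‖v‖, z₅)` is continuous near `truncL z`, maps `truncL z` to `z`, and maps a small
(path-connected) ball into `N ∖ A`. [folklore] -/
theorem exists_joinedIn_slice_nhds {A : Set (EuclideanSpace ℝ (Fin 6))} (hA : IsClosed A)
    {z : EuclideanSpace ℝ (Fin 6)} (hzN : ∑ i : Fin 5, z (Fin.castSucc i) ^ 2 = 1) (hzA : z ∉ A) :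
    ∃ ε : ℝ, 0 < ε ∧ ∀ q : EuclideanSpace ℝ (Fin 5), ∑ i : Fin 5, q i ^ 2 = 1 →
      dist q (truncL z) < ε →
      JoinedIn (({z : EuclideanSpace ℝ (Fin 6) | ∑ i : Fin 5, z (Fin.castSucc i) ^ 2 = 1} :
        Set (EuclideanSpace ℝ (Fin 6))) \ A) z (padL q + z 5 • (axis : EuclideanSpace ℝ (Fin 6))) := by
  set p₀ : EuclideanSpace ℝ (Fin 5) := truncL z with hp₀
  have hp₀1 : ‖p₀‖ = 1 := by
    rw [← Real.sqrt_sq (norm_nonneg _), hp₀, norm_truncL_sq, hzN, Real.sqrt_one]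
  have hp₀0 : p₀ ≠ 0 := by
    intro h; rw [h, norm_zero] at hp₀1; exact zero_ne_one hp₀1
  set Γ : EuclideanSpace ℝ (Fin 5) → EuclideanSpace ℝ (Fin 6) :=
    fun v => padL ((‖v‖⁻¹ : ℝ) • v) + z 5 • (axis : EuclideanSpace ℝ (Fin 6)) with hΓ
  have hΓc : ContinuousOn Γ {v | v ≠ 0} := by
    have hinv : ContinuousOn (fun v : EuclideanSpace ℝ (Fin 5) => (‖v‖⁻¹ : ℝ)) {v | v ≠ 0} :=
      continuous_norm.continuousOn.inv₀ fun v hv => norm_ne_zero_iff.2 hv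
    exact (padL.continuous.comp_continuousOn (hinv.smul continuousOn_id)).add continuousOn_const
  have hΓp₀ : Γ p₀ = z := by
    simp only [hΓ, hp₀1, inv_one, one_smul]
    exact (eq_vert z).symm
  have hΓN : ∀ v, v ≠ 0 → Γ v ∈ ({z : EuclideanSpace ℝ (Fin 6) | ∑ i : Fin 5, z (Fin.castSucc i) ^ 2 = 1} :
      Set (EuclideanSpace ℝ (Fin 6))) := by
    intro v hv
    have hn : ‖(‖v‖⁻¹ : ℝ) • v‖ = 1 := by
      rw [norm_smul, norm_inv, norm_norm, inv_mul_cancel₀ (norm_ne_zero_iff.2 hv)]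
    show ∑ i : Fin 5, (Γ v) (Fin.castSucc i) ^ 2 = 1
    simp only [hΓ, vert_apply_castSucc]
    rw [← EuclideanSpace.real_norm_sq_eq, hn, one_pow]
  -- a ball around `p₀` mapped off `A`
  have hAt : ContinuousAt Γ p₀ := hΓc.continuousAt (isOpen_compl_singleton.mem_nhds hp₀0)
  have hpre : Γ ⁻¹' Aᶜ ∈ 𝓝 p₀ :=
    hAt.preimage_mem_nhds (hA.isOpen_compl.mem_nhds (by rw [hΓp₀]; exact hzA))
  obtain ⟨ε, hε, hball⟩ := Metric.mem_nhds_iff.1 hpre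
  have hε' : 0 < min ε 1 := lt_min hε one_pos
  refine ⟨min ε 1, hε', fun q hq hdist => ?_⟩
  have hq1 : ‖q‖ = 1 := by
    have h2 : ‖q‖ ^ 2 = 1 := by rw [EuclideanSpace.real_norm_sq_eq, hq]
    have h0 := norm_nonneg q
    nlinarith
  -- the ball `B(p₀, min ε 1)` avoids `0`, is path connected, and `Γ` maps it into `N ∖ A`
  set S : Set (EuclideanSpace ℝ (Fin 5)) := Metric.ball p₀ (min ε 1) with hS
  have hS0 : S ⊆ {v | v ≠ 0} := by
    intro v hv h0
    rw [h0] at hv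
    rw [hS, Metric.mem_ball, dist_comm, dist_zero_right, hp₀1] at hv
    linarith [min_le_right ε 1]
  have hpc : IsPathConnected (Γ '' S) :=
    ((convex_ball p₀ (min ε 1)).isPathConnected ⟨p₀, Metric.mem_ball_self hε'⟩).image' (hΓc.mono hS0)
  have hsub : Γ '' S ⊆ (({z : EuclideanSpace ℝ (Fin 6) | ∑ i : Fin 5, z (Fin.castSucc i) ^ 2 = 1} :
      Set (EuclideanSpace ℝ (Fin 6))) \ A) := by
    rintro _ ⟨v, hv, rfl⟩
    exact ⟨hΓN v (hS0 hv), hball (Metric.ball_subset_ball (min_le_left _ _) hv)⟩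
  have hqS : q ∈ S := by rw [hS, Metric.mem_ball]; exact hdist
  have hΓq : Γ q = padL q + z 5 • (axis : EuclideanSpace ℝ (Fin 6)) := by
    simp only [hΓ, hq1, inv_one, one_smul]
  have key := (hpc.joinedIn (Γ p₀) (mem_image_of_mem Γ (Metric.mem_ball_self hε')) (Γ q)
    (mem_image_of_mem Γ hqS)).mono hsub
  rwa [hΓp₀, hΓq] at key

/-! ### Caps of `S⁴` have positive measure -/

/-- **Caps of the unit sphere `S⁴ ⊂ ℝ⁵` have positive `μHE⁴`-measure**: the spherical Hausdorff
measure `μHE[4]⌊S⁴` is nonzero and uniformly distributed (rotation invariant, the orthogonal group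
being transitive on `S⁴`), hence charges every ball of `S⁴`. [folklore] -/
theorem euclideanHausdorff_sphere_inter_ball_ne_zero
    (x : Metric.sphere (0 : EuclideanSpace ℝ (Fin 5)) 1) {r : ℝ} (hr : 0 < r) :
    (μHE[4] : Measure (EuclideanSpace ℝ (Fin 5)))
      (Metric.sphere (0 : EuclideanSpace ℝ (Fin 5)) 1 ∩ Metric.ball (x : EuclideanSpace ℝ (Fin 5)) r) ≠ 0 := by
  have hSpos : 0 < (μHE[4] : Measure (EuclideanSpace ℝ (Fin 5))) (Metric.sphere (0 : EuclideanSpace ℝ (Fin 5)) 1) :=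
    Literature.MeasureTheory.Hausdorff.euclideanHausdorffMeasure_unitSphere_pos
      (E := EuclideanSpace ℝ (Fin 5)) (d := 4) finrank_euclideanSpace_fin (by norm_num)
  have hme := MeasurableEmbedding.subtype_coe
    ((Metric.isClosed_sphere : IsClosed (Metric.sphere (0 : EuclideanSpace ℝ (Fin 5)) 1)).measurableSet)
  have h0 : (μHE[4] : Measure (EuclideanSpace ℝ (Fin 5))).comap
      (Subtype.val : Metric.sphere (0 : EuclideanSpace ℝ (Fin 5)) 1 → EuclideanSpace ℝ (Fin 5)) ≠ 0 := by
    intro h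
    have := Literature.MeasureTheory.Hausdorff.comap_euclideanHausdorff_univ (E := EuclideanSpace ℝ (Fin 5)) 4
    rw [h, Measure.coe_zero, Pi.zero_apply] at this
    exact hSpos.ne' this.symm
  have hpos := Literature.MeasureTheory.Hausdorff.measure_ball_pos_of_measure_ball_eq _
    (Literature.MeasureTheory.Hausdorff.comap_euclideanHausdorff_ball_eq 4) h0 x hr
  rw [hme.comap_apply, Literature.MeasureTheory.Hausdorff.image_val_ball] at hpos
  exact hpos.ne'

/-! ### Almost every fibre of the shadow is finite and regular -/

variable {M : Type} [TopologicalSpace M] [ChartedSpace (EuclideanSpace ℝ (Fin 4)) M] [IsManifold (𝓡 4) ∞ M]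
  [CompactSpace M] [MeasurableSpace M] [BorelSpace M] [SecondCountableTopology M] [Nonempty M]

/-- **Generic fibres of the shadow.** For `μHE⁴`-a.e. `p ∈ ℝ⁵` the fibre `{x | truncL (ι x) = p}`
of the shadow is finite and regular (`ν₅ ≠ 0` on it): the multiplicities `N_±` are a.e. finite
(their integrals are the finite areas `∫_{±ν₅>0} |ν₅|`, `lintegral_abs_nu5_eq_lintegral_encard`)
and the critical shadow is null (`hausdorffMeasure_shadow_critical_eq_zero`). [folklore] -/
theorem ae_exists_finset_fibre {ι ν : M → EuclideanSpace ℝ (Fin 6)}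
    (hι : Manifold.IsSmoothEmbedding (𝓡 4) (𝓡 6) ∞ ι)
    (hιN : ∀ x, ∑ i : Fin 5, ι x (Fin.castSucc i) ^ 2 = 1)
    (hνc : Continuous ν) (hνn : (euclideanMetric (EuclideanSpace ℝ (Fin 6))).IsUnitNormal (𝓡 4) ι ν 1)
    (hνt : ∀ x, ∑ i : Fin 5, ν x (Fin.castSucc i) * ι x (Fin.castSucc i) = 0) :
    ∀ᵐ p ∂(μHE[4] : Measure (EuclideanSpace ℝ (Fin 5))),
      ∃ F : Finset M, (∀ x, x ∈ F ↔ truncL (ι x) = p) ∧ ∀ x ∈ F, ν x 5 ≠ 0 := by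
  classical
  set σ : M → EuclideanSpace ℝ (Fin 5) := fun x => truncL (ι x) with hσ
  have h5c : Continuous fun x => ν x 5 := (EuclideanSpace.proj (5 : Fin 6)).continuous.comp hνc
  have hPpos : MeasurableSet {x : M | 0 < ν x 5} := (isOpen_lt continuous_const h5c).measurableSet
  have hPneg : MeasurableSet {x : M | ν x 5 < 0} := (isOpen_lt h5c continuous_const).measurableSet
  obtain ⟨hmP, hIP⟩ := lintegral_abs_nu5_eq_lintegral_encard hι hιN hνc hνn hνt hPpos fun x hx => ne_of_gt hx
  obtain ⟨hmN, hIN⟩ := lintegral_abs_nu5_eq_lintegral_encard hι hιN hνc hνn hνt hPneg fun x hx => ne_of_lt hx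
  obtain ⟨hfinP, hfinN, -⟩ := integral_nu5_eq_sub hι hνc hνn
  rw [hIP] at hfinP
  rw [hIN] at hfinN
  have hcrit := hausdorffMeasure_shadow_critical_eq_zero hι hιN hνc hνn hνt
  filter_upwards [ae_lt_top hmP hfinP.ne, ae_lt_top hmN hfinN.ne,
    measure_eq_zero_iff_ae_notMem.1 hcrit] with p h1 h2 h3
  have hf₁ : (σ ⁻¹' {p} ∩ {x : M | 0 < ν x 5}).Finite :=
    Set.encard_lt_top_iff.1 (ENat.toENNReal_lt_top.1 h1)
  have hf₂ : (σ ⁻¹' {p} ∩ {x : M | ν x 5 < 0}).Finite :=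
    Set.encard_lt_top_iff.1 (ENat.toENNReal_lt_top.1 h2)
  have hreg' : ∀ x, σ x = p → ν x 5 ≠ 0 := fun x hx h0 => h3 ⟨x, h0, hx⟩
  have hfib : (σ ⁻¹' {p}).Finite := by
    refine (hf₁.union hf₂).subset fun x hx => ?_
    rcases lt_or_gt_of_ne (hreg' x hx) with h | h
    · exact Or.inr ⟨hx, h⟩
    · exact Or.inl ⟨hx, h⟩
  refine ⟨hfib.toFinset, fun x => ?_, fun x hx => hreg' x ?_⟩
  · rw [Set.Finite.mem_toFinset]; rfl
  · exact (Set.Finite.mem_toFinset hfib).1 hx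

/-- Transport of the global jump along `a₊ ↔ a₋`: it vanishes. [folklore] -/
theorem ite_sub_ite_eq_zero_of_iff {P Q : Prop} [Decidable P] [Decidable Q] (h : P ↔ Q) :
    ((if Q then (1 : ℤ) else 0) - (if P then (1 : ℤ) else 0)) = 0 := by
  by_cases hP : P
  · rw [if_pos hP, if_pos (h.1 hP), sub_self]
  · rw [if_neg hP, if_neg (mt h.2 hP), sub_self]

end Pocket

/-- **W1a: with a pocket, the two sides of the cross-section differ.** For a compact boundaryless
`4`-manifold `M`, a smooth embedding `ι : M → N = S⁴ × ℝ ⊂ ℝ⁶`, a continuous unit normal field `ν`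
along `ι` tangent to `N`, and side constants `a₊, a₋` of the `±ν` push-offs (as produced by
`exists_side_constants`): if some point of `N ∖ ι(M)` is not joined in `N ∖ ι(M)` to any point of
height `≤ -R` (a pocket), then `¬ (a₊ ↔ a₋)`. Indeed, if `a₊ ↔ a₋` the global jump vanishes and
the telescoping crossing count (`low_sub_low_eq_sum`) makes every point off `ι(M)` of the vertical
line over a generic `p ∈ S⁴` lower (far below is lower); generic `p` have full measure, caps have
positive measure, and the pocket point is joined to `(p, z₅)` for `p` near its shadow. [folklore] -/
theorem helper_sidesDifferOfPocket : ∀ (M : Type) [TopologicalSpace M] [T2Space M] [SecondCountableTopology M] [ChartedSpace (EuclideanSpace ℝ (Fin 4)) M] [IsManifold (𝓡 4) ∞ M] [CompactSpace M] [MeasurableSpace M] [BorelSpace M] (ι ν : M → EuclideanSpace ℝ (Fin 6)), Manifold.IsSmoothEmbedding (𝓡 4) (𝓡 6) ∞ ι → (∀ x, ∑ i : Fin 5, ι x (Fin.castSucc i) ^ 2 = 1) → Continuous ν → (euclideanMetric (EuclideanSpace ℝ (Fin 6))).IsUnitNormal (𝓡 4) ι ν 1 → (∀ x, ∑ i : Fin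 5, ν x (Fin.castSucc i) * ι x (Fin.castSucc i) = 0) → ∀ (R t₀ : ℝ) (aP aM : Prop), 0 < t₀ → (∀ x, ∀ t ∈ Set.Ioc (0 : ℝ) t₀, (fun z : EuclideanSpace ℝ (Fin 6) => (‖truncL z‖⁻¹ : ℝ) • (z - z (5 : Fin 6) • (axis : EuclideanSpace ℝ (Fin 6))) + z (5 : Fin 6) • (axis : EuclideanSpace ℝ (Fin 6))) (ι x + t • ν x) ∈ ({z : EuclideanSpace ℝ (Fin 6) | ∑ i : Fin 5, z (Fin.castSucc i) ^ 2 = 1} : Set (EuclideanSpace ℝ (Fin 6))) \ Set.range ι ∧ ((∃ b : EuclideanSpace ℝ (Fin 6), (∑ i : Fin 5, b (Fin.castSucc i) ^ 2 = 1) ∧ b (5 : Fin 6) ≤ -R ∧ JoinedIn (({z : EuclideanSpace ℝ (Fin 6) | ∑ i : Fin 5, z (Fin.castSucc i) ^ 2 = 1} : Set (EuclideanSpace ℝ (Fin 6))) \ Set.range ι) ((fun z : EuclideanSpace ℝ (Fin 6) => (‖truncL z‖⁻¹ : ℝ) • (z - z (5 : Fin 6) • (axis : EuclideanSpace ℝ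 (Fin 6))) + z (5 : Fin 6) • (axis : EuclideanSpace ℝ (Fin 6))) (ι x + t • ν x)) b) ↔ aP)) → (∀ x, ∀ t ∈ Set.Ioc (0 : ℝ) t₀, (fun z : EuclideanSpace ℝ (Fin 6) => (‖truncL z‖⁻¹ : ℝ) • (z - z (5 : Fin 6) • (axis : EuclideanSpace ℝ (Fin 6))) + z (5 : Fin 6) • (axis : EuclideanSpace ℝ (Fin 6))) (ι x + t • (-ν x)) ∈ ({z : EuclideanSpace ℝ (Fin 6) | ∑ i : Fin 5, z (Fin.castSucc i) ^ 2 = 1} : Set (EuclideanSpace ℝ (Fin 6))) \ Set.range ι ∧ ((∃ b : EuclideanSpace ℝ (Fin 6), (∑ i : Fin 5, b (Fin.castSucc i) ^ 2 = 1) ∧ b (5 : Fin 6) ≤ -R ∧ JoinedIn (({z : EuclideanSpace ℝ (Fin 6) | ∑ i : Fin 5, z (Fin.castSucc i) ^ 2 = 1} : Set (EuclideanSpace ℝ (Fin 6))) \ Set.range ι) ((fun z : EuclideanSpace ℝ (Fin 6) => (‖truncL z‖⁻¹ : ℝ) • (z - z (5 : Fin 6) • (axis : EuclideanSpace ℝ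 (Fin 6))) + z (5 : Fin 6) • (axis : EuclideanSpace ℝ (Fin 6))) (ι x + t • (-ν x))) b) ↔ aM)) → (∃ z : EuclideanSpace ℝ (Fin 6), ∑ i : Fin 5, z (Fin.castSucc i) ^ 2 = 1 ∧ z ∉ Set.range ι ∧ ∀ b : EuclideanSpace ℝ (Fin 6), ∑ i : Fin 5, b (Fin.castSucc i) ^ 2 = 1 → b 5 ≤ -R → ¬ JoinedIn ({z : EuclideanSpace ℝ (Fin 6) | ∑ i : Fin 5, z (Fin.castSucc i) ^ 2 = 1} \ Set.range ι) z b) → ¬ (aP ↔ aM) := by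
  intro M _ _ _ _ _ _ _ _ ι ν hι hιN hνc hνn hνt R t₀ aP aM ht₀ hPm hMm hpk hiff
  obtain ⟨z, hzN, hzr, hpocket⟩ := hpk
  classical
  have hpz : ∑ i : Fin 5, (truncL z) i ^ 2 = 1 := by simpa only [truncL_apply] using hzN
  -- (0) if `M` is empty, `N ∖ ι(M) = N` has no pocket (go straight down)
  rcases isEmpty_or_nonempty M with hM | hM
  · refine hpocket (padL (truncL z) + (-|R| - 1) • (axis : EuclideanSpace ℝ (Fin 6))) (vert_mem_Ncyl hpz _)
      (by rw [vert_apply_five]; linarith [le_abs_self R]) ?_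
    have key := joinedIn_vert (ι := ι) hpz (s₀ := z 5) (s₁ := -|R| - 1) fun s _ ⟨x, _⟩ => isEmptyElim x
    rwa [← eq_vert z] at key
  have hιc : Continuous ι := hι.contMDiff.continuous
  -- (1) the heights of `ι(M)` are bounded
  have hcont : Continuous fun x => |ι x 5| :=
    continuous_abs.comp ((EuclideanSpace.proj (5 : Fin 6)).continuous.comp hιc)
  obtain ⟨B, hB⟩ := (isCompact_range hcont).bddAbove
  have hB' : ∀ x, |ι x 5| ≤ B := fun x => hB ⟨x, rfl⟩
  -- (2) the pocket point is joined to the nearby points of its slice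
  obtain ⟨ε, hε, hjoinε⟩ := exists_joinedIn_slice_nhds (isCompact_range hιc).isClosed hzN hzr
  -- (3) a generic shadow point in the cap around `truncL z`
  have hp₀S : truncL z ∈ Metric.sphere (0 : EuclideanSpace ℝ (Fin 5)) 1 := by
    rw [mem_sphere_zero_iff_norm, ← Real.sqrt_sq (norm_nonneg _), norm_truncL_sq, hzN, Real.sqrt_one]
  have hfr : ∃ᵐ p ∂(μHE[4] : Measure (EuclideanSpace ℝ (Fin 5))),
      p ∈ Metric.sphere (0 : EuclideanSpace ℝ (Fin 5)) 1 ∩ Metric.ball (truncL z) ε :=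
    frequently_ae_mem_iff.2 (euclideanHausdorff_sphere_inter_ball_ne_zero ⟨truncL z, hp₀S⟩ hε)
  obtain ⟨q, ⟨hqS, hqB⟩, F, hFmem, hreg⟩ :=
    (hfr.and_eventually (ae_exists_finset_fibre hι hιN hνc hνn hνt)).exists
  have hq : ∑ i : Fin 5, q i ^ 2 = 1 := Literature.Geometry.Manifold.CylinderSlice.sum_sq_eq_one ⟨q, hqS⟩
  have hjoin := hjoinε q hq (Metric.mem_ball.1 hqB)
  -- (4) the vertical line over `q`, from far below up to the height of `z`
  set R' : ℝ := |R| + |B| + |z 5| + 1 with hR'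
  have hR'pos : 0 < R' := by rw [hR']; positivity
  have hfree : ∀ s : ℝ, B < |s| → padL q + s • (axis : EuclideanSpace ℝ (Fin 6)) ∉ range ι := by
    intro s hs hmem
    obtain ⟨x, -, hxs⟩ := (vert_mem_range_iff ι q s).1 hmem
    have := hB' x
    rw [hxs] at this
    linarith
  have h₀ : padL q + (-R') • (axis : EuclideanSpace ℝ (Fin 6)) ∉ range ι :=
    hfree _ (by rw [abs_neg, abs_of_pos hR'pos, hR']; linarith [le_abs_self B, abs_nonneg R, abs_nonneg (z 5)])
  have h₁ : padL q + z 5 • (axis : EuclideanSpace ℝ (Fin 6)) ∉ range ι := hjoin.target_mem.2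
  have hlt : -R' < z 5 := by
    rw [hR']; linarith [neg_abs_le (z 5), abs_nonneg R, abs_nonneg B]
  have key := low_sub_low_eq_sum hι hιN hνn hνt (fun x t ht => (hPm x t ht).2)
    (fun x t ht => (hMm x t ht).2) ht₀ hq hFmem hreg _ (-R') (z 5) hlt h₀ h₁ rfl
  rw [if_pos (low_of_le (R := R) ⟨vert_mem_Ncyl hq _, h₀⟩
      (by rw [vert_apply_five, hR']; linarith [le_abs_self R, abs_nonneg B, abs_nonneg (z 5)])),
    ite_sub_ite_eq_zero_of_iff hiff, zero_mul] at key
  split_ifs at key with hL1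
  · obtain ⟨b, hb, hb5, hj⟩ := (low_iff_of_joinedIn hjoin).2 hL1
    exact hpocket b hb hb5 hj
  · norm_num at key

end Summit.SmoothPoincare4.SmoothPoincare4.Theorems.CylinderRungTwo.KillingFlux

end
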